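import Summits.Ventures.Crystal3D.Theorems.StickyWulffConstantCoaxialWallLawTailResidueDefsM
import HarnessLib

/-!
# Definitions T5: the DEGREE SPLIT of `TailResidue.MultiGrainSmall` (crux `CoaxialWallLaw`, stmt-Ventures-19481; cf-p1 DECISION (clxxxii)
# «T5 re-typing granted: `MultiGrainSmallLow 3` closed by name, `MultiGrainSmallHigh 3` open under KissingGap/KissingClassification»)

HONEST FRAMING. Venture `Summits/Ventures/Crystal3D` (cell `crystal3d-full`); DEFINITIONS (+ their bookkeeping equivalence) for the crux `CoaxialWallLaw`
(stmt-Ventures-19481, `route-Ventures-StickyWulffConstant`), registered line 'CoaxialWallLawCertificates' (planner cf-p1).  Nothing substantive is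
claimed; F-C1 not moved.  WHY (memo HOME/wall-19481-p2/F-TAIL-g10.md §9): the seam stub `MultiGrainSmall s` («off-site, not mono-module ⇒ deletion
on-site or joint (A)-summand ≤ s») is settled CENSUS-FREE at payers of small degree by the payer-pool bound (`…PayerPoolBound`:
`Σ_A(z) ≤ 13·deg z/(12 − deg z)`, so `deg z ≤ 3 ⇒ ≤ 13/3 < 2√6`), while payers of degree `≥ 4` read by fully coordinated crystallites (jammed dust
next to a crystal, second-generation twins) need the kissing facts and a rigidity + census argument.  The split by the payer's degree `k₀`:
* **`MultiGrainSmallLow s k₀`** — `MultiGrainSmall s` restricted to payers with `deg z ≤ k₀`;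
* **`MultiGrainSmallHigh s k₀`** — `MultiGrainSmall s` restricted to payers with `k₀ < deg z`;
* `multiGrainSmall_of_low_of_high`, `multiGrainSmallLow_of_multiGrainSmall`, `multiGrainSmallHigh_of_multiGrainSmall`,
  `multiGrainSmall_iff_low_and_high` — the split is exact.
Registered texts (Certificates v4): `stub_multiGrainSmallLow : TailResidue.MultiGrainSmallLow (2 * Real.sqrt 6) 3` (closed by
`TailResidue.multiGrainSmallLow_three`, `…TailResidueClosingT5`) and `stub_multiGrainSmallHigh : KissingGap (5 / 2) → KissingClassification (5 / 2) →
TailResidue.MultiGrainSmallHigh (2 * Real.sqrt 6) 3` (OPEN; adversarial families (A1)–(A3) of F-TAIL-g10 §9(d)).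
WHAT THIS IS NOT: no proof of either half; F-C1 not moved.
-/

noncomputable section

namespace Summit.Ventures.Crystal3D.Theorems

namespace TailResidue

open Summit.Ventures.Crystal3D Finset
open scoped InnerProductSpace

open scoped Classical in
/-- **MULTI-GRAIN SMALLNESS AT LOW-DEGREE PAYERS**: `MultiGrainSmall s` restricted to payers `z` with `deg z ≤ k₀` — at every off-site payer window
that is not mono-module and whose payer touches at most `k₀` balls, a deletion of inessential balls lands on-site or the joint (A)-summand of `L` is `≤ s`.
Registered at `s = 2√6`, `k₀ = 3` (closed census-free by the payer-pool bound). -/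
def MultiGrainSmallLow (s : ℝ) (k₀ : ℕ) : Prop :=
  ∀ L : EuclideanSpace ℝ (Fin 3) ≃ₗᵢ[ℝ] EuclideanSpace ℝ (Fin 3),
  ∀ X : Finset (EuclideanSpace ℝ (Fin 3)), (∀ p ∈ X, ∀ q ∈ X, p ≠ q → 1 ≤ dist p q) →
  ∀ z ∈ X, (X.filter fun q => dist z q = 1).card ≤ 11 → ¬ OnSiteAt coaxialModuleUniverse X z → ¬ MonoModuleAt L X z →
    (X.filter fun q => dist z q = 1).card ≤ k₀ →
    HasDeletionOnSite X z ∨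
      localSummandA WordVersion.v2 (basalSystem L)
        (basalSystem (((ℝ ∙ EuclideanSpace.single (2 : Fin 3) (1 : ℝ)).reflection).trans L)) X z ≤ s

open scoped Classical in
/-- **MULTI-GRAIN SMALLNESS AT HIGH-DEGREE PAYERS**: `MultiGrainSmall s` restricted to payers `z` with `k₀ < deg z` — the jammed-dust-next-to-a-crystal
and second-generation-twin regimes (F-TAIL-g10 §9).  Registered at `s = 2√6`, `k₀ = 3`, UNDER `KissingGap (5/2)` and `KissingClassification (5/2)`. -/
def MultiGrainSmallHigh (s : ℝ) (k₀ : ℕ) : Prop :=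
  ∀ L : EuclideanSpace ℝ (Fin 3) ≃ₗᵢ[ℝ] EuclideanSpace ℝ (Fin 3),
  ∀ X : Finset (EuclideanSpace ℝ (Fin 3)), (∀ p ∈ X, ∀ q ∈ X, p ≠ q → 1 ≤ dist p q) →
  ∀ z ∈ X, (X.filter fun q => dist z q = 1).card ≤ 11 → ¬ OnSiteAt coaxialModuleUniverse X z → ¬ MonoModuleAt L X z →
    k₀ < (X.filter fun q => dist z q = 1).card →
    HasDeletionOnSite X z ∨
      localSummandA WordVersion.v2 (basalSystem L)
        (basalSystem (((ℝ ∙ EuclideanSpace.single (2 : Fin 3) (1 : ℝ)).reflection).trans L)) X z ≤ s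

/-- **The split is exact (⇐)**: low-degree and high-degree smallness together give `MultiGrainSmall`. -/
theorem multiGrainSmall_of_low_of_high {s : ℝ} {k₀ : ℕ} (hlow : MultiGrainSmallLow s k₀) (hhigh : MultiGrainSmallHigh s k₀) :
    MultiGrainSmall s := by
  intro L X hX z hz hdeg hoff hM
  by_cases hk : (X.filter fun q => dist z q = 1).card ≤ k₀
  · exact hlow L X hX z hz hdeg hoff hM hk
  · exact hhigh L X hX z hz hdeg hoff hM (lt_of_not_ge hk)

/-- **The split is exact (⇒, low part).** -/
theorem multiGrainSmallLow_of_multiGrainSmall {s : ℝ} (k₀ : ℕ) (h : MultiGrainSmall s) : MultiGrainSmallLow s k₀ :=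
  fun L X hX z hz hdeg hoff hM _ => h L X hX z hz hdeg hoff hM

/-- **The split is exact (⇒, high part).** -/
theorem multiGrainSmallHigh_of_multiGrainSmall {s : ℝ} (k₀ : ℕ) (h : MultiGrainSmall s) : MultiGrainSmallHigh s k₀ :=
  fun L X hX z hz hdeg hoff hM _ => h L X hX z hz hdeg hoff hM

/-- `MultiGrainSmall s ↔ MultiGrainSmallLow s k₀ ∧ MultiGrainSmallHigh s k₀`, for every cut `k₀`. -/
theorem multiGrainSmall_iff_low_and_high (s : ℝ) (k₀ : ℕ) :
    MultiGrainSmall s ↔ MultiGrainSmallLow s k₀ ∧ MultiGrainSmallHigh s k₀ :=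
  ⟨fun h => ⟨multiGrainSmallLow_of_multiGrainSmall k₀ h, multiGrainSmallHigh_of_multiGrainSmall k₀ h⟩,
    fun h => multiGrainSmall_of_low_of_high h.1 h.2⟩

/-- Both halves are monotone in the line. -/
theorem multiGrainSmallLow_mono {s t : ℝ} {k₀ : ℕ} (hst : s ≤ t) (h : MultiGrainSmallLow s k₀) : MultiGrainSmallLow t k₀ := by
  intro L X hX z hz hdeg hoff hM hk
  rcases h L X hX z hz hdeg hoff hM hk with h' | h'
  · exact Or.inl h'
  · exact Or.inr (h'.trans hst)

/-- Both halves are monotone in the line. -/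
theorem multiGrainSmallHigh_mono {s t : ℝ} {k₀ : ℕ} (hst : s ≤ t) (h : MultiGrainSmallHigh s k₀) : MultiGrainSmallHigh t k₀ := by
  intro L X hX z hz hdeg hoff hM hk
  rcases h L X hX z hz hdeg hoff hM hk with h' | h'
  · exact Or.inl h'
  · exact Or.inr (h'.trans hst)

end TailResidue

end Summit.Ventures.Crystal3D.Theorems

end
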